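import Literature.NumberTheory.K2Lit.DoubledTensorEmbedding
import Literature.NumberTheory.Automorphic.UnitaryGroupPlaceInclusion
import Literature.NumberTheory.Automorphic.UnitaryGroupAdelicProduct
import HarnessLib

/-!
# Place components of the tensor embedding `h ↦ h ⊗ 1_{V′}` of the doubled unitary group (organ T2-a of the #42S «SPAN» road)

Track B ∕ hLiu418 = stmt-HodgeConjecture-24832, line `K2_Liu_CurveThetaSigs`; LEAD F0P6-plan (g11) rulings «M-155j» §3 («then T2») and
«M-155k» (7)(9) (GO 04:58:33Z); census `K2/K2Liu-p03/g4/CENSUS-T2-SphericalSWValue.K2Liu-p03-g4.md`; seat `hodgecm-mathlib-K2Liu-p03` (g4).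
Bookkeeping for the spherical-invariance organ T2-e («the Siegel–Weil section of `𝟙` is right-`K_{H,v}`-invariant at good places»): the
embedding ★ `K2Lit.SiegelDoubled.tensorEmb : U(𝔻)(𝔸) →* U(𝔻 ⊗ V′)(𝔸)`, whose matrix is `reindex epsD (h ⊗ₖ 1)` (★ `coe_tensorEmb`), is
FUNCTORIAL IN THE COEFFICIENT RING, hence preserves trivial place components and integrality:

* `map_coe_tensorEmb` — for every ring homomorphism `f` out of `𝔸_L`, `(h ⊗ 1).map f = reindex epsD ((h.map f) ⊗ₖ 1)`;
* `archPart_tensorEmb_eq_one` — `h_∞ = 1 ⇒ (h ⊗ 1)_∞ = 1` (★ `UnitaryGroup.archPart`);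
* `evalPlace_finPart_tensorEmb_eq_one` — `h_w = 1 ⇒ (h ⊗ 1)_w = 1` (★ `UnitaryGroup.evalPlace ∘ finPart`);
* `evalPlace_finPart_tensorEmb_mem_localInt` — `h_w ∈ U(𝒪_w) ⇒ (h ⊗ 1)_w ∈ U(𝒪_w)` (entries of `A ⊗ₖ 1` are entries of `A` or `0`; ★ `mem_localInt_iff`,
  ★ `mem_glInt_iff`);
* `eq_inclPlaceAdelic_of_archPart_eq_one` (generic, any datum) — an adelic point with trivial archimedean component and trivial components off
  `v` IS the place-`v` inclusion of its `v`-component (★ `archToAdelic_mul_finAdelicToAdelic`, ★ `finAdelicEquiv_inclPlace_apply`);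
* **`exists_mem_localInt_tensorEmb_inclPlaceAdelic`** — for `u ∈ U(𝔻)(𝒪_v)` there is `u′ ∈ U(𝔻 ⊗ V′)(𝒪_v)` with
  `tensorEmb (ι_v u) = ι_v u′` (★ `inclPlaceAdelic`): the tensor embedding carries the good maximal compact at `v` into the good maximal compact.
[cite: Kudla1994, §2 (doubled space, Siegel parabolic)] [cite: HarrisKudlaSweet1996, §1 (1.8)] [cite: BorelJacquet1979, §4.1] [cite: PlatonovRapinchuk1994, §5.1]

No definition, no instance, no named fact, no `sorry`; axioms ⊆ {propext, Classical.choice, Quot.sound}.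

## References
* [Kudla1994] S. Kudla, *Splitting metaplectic covers of dual reductive pairs*, Israel J. Math. 87 (1994), §2.
* [HarrisKudlaSweet1996] M. Harris, S. Kudla, W. J. Sweet, J. AMS 9 (1996), §1 (1.8).
* [BorelJacquet1979] A. Borel, H. Jacquet, Proc. Symp. Pure Math. 33.1 (1979), §4.1 (`g = g_∞ · g_f`, place components).
* [PlatonovRapinchuk1994] V. Platonov, A. Rapinchuk, *Algebraic Groups and Number Theory* (1994), §5.1 (`G(𝒪_v)` in a matrix realisation).

HONEST LABEL: HC_CM is proved only modulo the 7 printed citations (2 remaining named inputs: hLiu418 = stmt-HodgeConjecture-24832, h413 =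
stmt-HodgeConjecture-24833) until rung 0 closes; this helper moves no counter.
-/

set_option autoImplicit false

set_option linter.dupNamespace false

noncomputable section

open scoped Matrix Kronecker
open NumberField IsDedekindDomain

namespace Summit.HodgeConjecture.HodgeConjecture.Cruxes.HLiu418.K2LiuTensorEmbPlaceComponents

open Literature.NumberTheory.Automorphic Literature.NumberTheory.Automorphic.UnitaryGroup Literature.NumberTheory.GaloisRepresentations
open Literature.NumberTheory.GelbartRogawski1991 Literature.NumberTheory.GelbartRogawski1991.GRConstruction
open Literature.NumberTheory.K2Lit.SiegelDoubled

/-! ## §0 A generic lemma: adelic points supported at one place -/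

/-- **An adelic point with trivial archimedean component and trivial finite components off `v` is the place-`v` inclusion of its `v`-component.**
[cite: BorelJacquet1979, §4.1] [cite: PlatonovRapinchuk1994, §5.1] -/
theorem eq_inclPlaceAdelic_of_archPart_eq_one (F E : Type) [Field F] [NumberField F] [Field E] [NumberField E] [Algebra F E]
    (c : E ≃ₐ[F] E) (N : ℕ) (J : Matrix (Fin N) (Fin N) E) (v : HeightOneSpectrum (𝓞 F))
    (g : (UnitaryGroup.adelicGroupData F E c N J).Adelic) (h₁ : UnitaryGroup.archPart F E c N J g = 1)
    (h₂ : ∀ w : HeightOneSpectrum (𝓞 F), w ≠ v → UnitaryGroup.evalPlace F E c N J w (UnitaryGroup.finPart F E c N J g) = 1) :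
    g = UnitaryGroup.inclPlaceAdelic F E c N J v (UnitaryGroup.evalPlace F E c N J v (UnitaryGroup.finPart F E c N J g)) := by
  have hfin : UnitaryGroup.finPart F E c N J g =
      UnitaryGroup.inclPlace F E c N J v (UnitaryGroup.evalPlace F E c N J v (UnitaryGroup.finPart F E c N J g)) := by
    classical
    apply (UnitaryGroup.finAdelicEquiv F E c N J).injective
    ext w : 1
    rw [UnitaryGroup.finAdelicEquiv_inclPlace_apply]
    rcases eq_or_ne w v with rfl | hw
    · rw [Pi.mulSingle_eq_same]
      rfl
    · rw [Pi.mulSingle_eq_of_ne hw]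
      exact h₂ w hw
  calc g = UnitaryGroup.archToAdelic F E c N J (UnitaryGroup.archPart F E c N J g) *
        UnitaryGroup.finAdelicToAdelic F E c N J (UnitaryGroup.finPart F E c N J g) :=
      (UnitaryGroup.archToAdelic_mul_finAdelicToAdelic F E c N J g).symm
    _ = UnitaryGroup.finAdelicToAdelic F E c N J (UnitaryGroup.finPart F E c N J g) := by rw [h₁, map_one, one_mul]
    _ = UnitaryGroup.inclPlaceAdelic F E c N J v (UnitaryGroup.evalPlace F E c N J v (UnitaryGroup.finPart F E c N J g)) := by
      rw [UnitaryGroup.inclPlaceAdelic_apply]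
      exact congrArg _ hfin

/-! ## §1 The matrix of `h ⊗ 1` is functorial in the coefficient ring -/

variable (L : Type) [Field L] [NumberField L] [IsCMField L]
variable {N M n : ℕ} (e : Fin N × Fin M ≃ Fin n)
  (dV : Fin N → L) (hdV : ∀ i, IsCMField.complexConj L (dV i) = dV i)
  (dW : Fin M → L) (hdW : ∀ i, IsCMField.complexConj L (dW i) = dW i)
variable {M₂ M' n' : ℕ} (eW : Fin M × Fin M₂ ≃ Fin M') (e' : Fin N × Fin M' ≃ Fin n')
  (dV' : Fin M₂ → L) (hdV' : ∀ k, IsCMField.complexConj L (dV' k) = dV' k)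

omit [NumberField L] [IsCMField L] in
/-- `(A ⊗ₖ 1).map f = (A.map f) ⊗ₖ 1` for a ring homomorphism `f`. [folklore] -/
theorem kronecker_one_map {R S : Type} [CommRing R] [CommRing S] (f : R →+* S) {m : ℕ}
    (A : Matrix (Fin m) (Fin m) R) (k : ℕ) :
    (A ⊗ₖ (1 : Matrix (Fin k) (Fin k) R)).map f = (A.map f) ⊗ₖ (1 : Matrix (Fin k) (Fin k) S) := by
  ext ⟨i, a⟩ ⟨j, b⟩
  simp only [Matrix.map_apply, Matrix.kroneckerMap_apply, Matrix.one_apply, map_mul]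
  split_ifs <;> simp

/-- **`(h ⊗ 1).map f = reindex epsD ((h.map f) ⊗ₖ 1)`** for every ring homomorphism `f` out of `𝔸_L` (★ `coe_tensorEmb`).
[cite: Kudla1994, §2 (doubled space, Siegel parabolic)] -/
theorem map_coe_tensorEmb {S : Type} [CommRing S] (f : AdeleRing (𝓞 L) L →+* S) (h : HA L e dV hdV dW hdW) :
    (((tensorEmb L e dV hdV dW hdW eW e' dV' hdV' h : HA L e' dV hdV (tensorFrame L dW eW dV') (tensorFrame_real L dW hdW eW dV' hdV')) :
        GL (Fin (n' + n')) (AdeleRing (𝓞 L) L)) : Matrix (Fin (n' + n')) (Fin (n' + n')) (AdeleRing (𝓞 L) L)).map f =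
      Matrix.reindex (epsD e eW e') (epsD e eW e')
        (((((h : HA L e dV hdV dW hdW) : GL (Fin (n + n)) (AdeleRing (𝓞 L) L)) : Matrix (Fin (n + n)) (Fin (n + n)) (AdeleRing (𝓞 L) L)).map f) ⊗ₖ
          (1 : Matrix (Fin M₂) (Fin M₂) S)) := by
  rw [coe_tensorEmb, Matrix.reindex_apply, Matrix.reindex_apply, ← Matrix.submatrix_map, kronecker_one_map]

/-! ## §2 Trivial place components are preserved -/

/-- **`h_∞ = 1 ⇒ (h ⊗ 1)_∞ = 1`** (the `K_∞`-matrix of `h ⊗ 1` is `reindex epsD ((h_∞) ⊗ 1)`). [cite: BorelJacquet1979, §4.1] -/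
theorem archPart_tensorEmb_eq_one (h : HA L e dV hdV dW hdW)
    (h₁ : UnitaryGroup.archPart (Fp L) L (IsCMField.complexConj L) (n + n) (hermD L e dV hdV dW hdW) h = 1) :
    UnitaryGroup.archPart (Fp L) L (IsCMField.complexConj L) (n' + n') (hermD L e' dV hdV (tensorFrame L dW eW dV') (tensorFrame_real L dW hdW eW dV' hdV'))
      (tensorEmb L e dV hdV dW hdW eW e' dV' hdV' h) = 1 := by
  -- `h_∞ = 1` as a statement about the `K_∞`-matrix of `h`
  have hy1 : GLn.fstHom (n + n) L ((h : HA L e dV hdV dW hdW) : GL (Fin (n + n)) (AdeleRing (𝓞 L) L)) = 1 := by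
    have h' := congrArg Subtype.val h₁
    simp only [UnitaryGroup.coe_archPart, UnitaryGroup.adelicVal_apply, GLn.toMixed_apply, OneMemClass.coe_one] at h'
    exact (GLn.infiniteEquivMixed (n + n) L).injective (h'.trans (map_one _).symm)
  have hy2 : ((((h : HA L e dV hdV dW hdW) : GL (Fin (n + n)) (AdeleRing (𝓞 L) L)) :
      Matrix (Fin (n + n)) (Fin (n + n)) (AdeleRing (𝓞 L) L)).map (UnitaryGroup.adeleFst L)) = 1 := by
    have h' := congrArg (fun u : GL (Fin (n + n)) (InfiniteAdeleRing L) => (u : Matrix (Fin (n + n)) (Fin (n + n)) (InfiniteAdeleRing L))) hy1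
    rw [Units.val_one] at h'
    exact h'
  -- the `K_∞`-matrix of `h ⊗ 1` is `1`
  have hfst : GLn.fstHom (n' + n') L ((tensorEmb L e dV hdV dW hdW eW e' dV' hdV' h :
      HA L e' dV hdV (tensorFrame L dW eW dV') (tensorFrame_real L dW hdW eW dV' hdV')) : GL (Fin (n' + n')) (AdeleRing (𝓞 L) L)) = 1 := by
    refine Units.ext ?_
    rw [Units.val_one]
    change ((((tensorEmb L e dV hdV dW hdW eW e' dV' hdV' h : HA L e' dV hdV (tensorFrame L dW eW dV') (tensorFrame_real L dW hdW eW dV' hdV')) :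
        GL (Fin (n' + n')) (AdeleRing (𝓞 L) L)) : Matrix (Fin (n' + n')) (Fin (n' + n')) (AdeleRing (𝓞 L) L)).map (UnitaryGroup.adeleFst L)) = 1
    rw [map_coe_tensorEmb, hy2, Matrix.one_kronecker_one, Matrix.reindex_apply, Matrix.submatrix_one_equiv]
  refine Subtype.ext ?_
  rw [UnitaryGroup.coe_archPart, UnitaryGroup.adelicVal_apply, GLn.toMixed_apply, hfst, map_one, OneMemClass.coe_one]

/-- the `w′`-component matrix of `((h ⊗ 1)_f)_w` is `reindex epsD ((h_{w′}) ⊗ₖ 1)`. [cite: PlatonovRapinchuk1994, §5.1] -/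
theorem coe_evalPlace_finPart_tensorEmb (w : HeightOneSpectrum (𝓞 (Fp L))) (w' : UnitaryGroup.PlacesOver L w) (h : HA L e dV hdV dW hdW) :
    (((UnitaryGroup.evalPlace (Fp L) L (IsCMField.complexConj L) (n' + n') (hermD L e' dV hdV (tensorFrame L dW eW dV') (tensorFrame_real L dW hdW eW dV' hdV')) w
        (UnitaryGroup.finPart (Fp L) L (IsCMField.complexConj L) (n' + n') (hermD L e' dV hdV (tensorFrame L dW eW dV') (tensorFrame_real L dW hdW eW dV' hdV'))
          (tensorEmb L e dV hdV dW hdW eW e' dV' hdV' h)) :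
        UnitaryGroup.localPi L (IsCMField.complexConj L) (n' + n') (hermD L e' dV hdV (tensorFrame L dW eW dV') (tensorFrame_real L dW hdW eW dV' hdV')) w) :
        UnitaryGroup.LocalGLPi L (n' + n') w) w' : Matrix (Fin (n' + n')) (Fin (n' + n')) (w'.1.adicCompletion L)) =
      Matrix.reindex (epsD e eW e') (epsD e eW e')
        ((((UnitaryGroup.evalPlace (Fp L) L (IsCMField.complexConj L) (n + n) (hermD L e dV hdV dW hdW) w
            (UnitaryGroup.finPart (Fp L) L (IsCMField.complexConj L) (n + n) (hermD L e dV hdV dW hdW) h) :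
            UnitaryGroup.localPi L (IsCMField.complexConj L) (n + n) (hermD L e dV hdV dW hdW) w) : UnitaryGroup.LocalGLPi L (n + n) w) w' :
            Matrix (Fin (n + n)) (Fin (n + n)) (w'.1.adicCompletion L)) ⊗ₖ (1 : Matrix (Fin M₂) (Fin M₂) (w'.1.adicCompletion L))) := by
  rw [UnitaryGroup.coe_evalPlace_apply, UnitaryGroup.coe_evalPlace_apply, UnitaryGroup.coe_finPart, UnitaryGroup.coe_finPart,
    UnitaryGroup.adelicVal_apply, UnitaryGroup.adelicVal_apply]
  have key : ∀ (G : GL (Fin (n' + n')) (AdeleRing (𝓞 L) L)),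
      ((GLn.evalAt (n' + n') L w'.1 (GLn.sndHom (n' + n') L G) : GL (Fin (n' + n')) (w'.1.adicCompletion L)) :
          Matrix (Fin (n' + n')) (Fin (n' + n')) (w'.1.adicCompletion L)) =
        (G : Matrix (Fin (n' + n')) (Fin (n' + n')) (AdeleRing (𝓞 L) L)).map
          ((AdelicGroupData.finiteAdeleEval L w'.1).comp (UnitaryGroup.adeleSnd L)) := by
    intro G
    ext i j
    rfl
  have key' : ∀ (G : GL (Fin (n + n)) (AdeleRing (𝓞 L) L)),
      ((GLn.evalAt (n + n) L w'.1 (GLn.sndHom (n + n) L G) : GL (Fin (n + n)) (w'.1.adicCompletion L)) :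
          Matrix (Fin (n + n)) (Fin (n + n)) (w'.1.adicCompletion L)) =
        (G : Matrix (Fin (n + n)) (Fin (n + n)) (AdeleRing (𝓞 L) L)).map
          ((AdelicGroupData.finiteAdeleEval L w'.1).comp (UnitaryGroup.adeleSnd L)) := by
    intro G
    ext i j
    rfl
  rw [key, key']
  exact map_coe_tensorEmb L e dV hdV dW hdW eW e' dV' hdV' _ h

/-- **`h_w = 1 ⇒ (h ⊗ 1)_w = 1`**. [cite: PlatonovRapinchuk1994, §5.1] [cite: BorelJacquet1979, §4.1] -/
theorem evalPlace_finPart_tensorEmb_eq_one (w : HeightOneSpectrum (𝓞 (Fp L))) (h : HA L e dV hdV dW hdW)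
    (hw : UnitaryGroup.evalPlace (Fp L) L (IsCMField.complexConj L) (n + n) (hermD L e dV hdV dW hdW) w
      (UnitaryGroup.finPart (Fp L) L (IsCMField.complexConj L) (n + n) (hermD L e dV hdV dW hdW) h) = 1) :
    UnitaryGroup.evalPlace (Fp L) L (IsCMField.complexConj L) (n' + n') (hermD L e' dV hdV (tensorFrame L dW eW dV') (tensorFrame_real L dW hdW eW dV' hdV')) w
      (UnitaryGroup.finPart (Fp L) L (IsCMField.complexConj L) (n' + n') (hermD L e' dV hdV (tensorFrame L dW eW dV') (tensorFrame_real L dW hdW eW dV' hdV'))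
        (tensorEmb L e dV hdV dW hdW eW e' dV' hdV' h)) = 1 := by
  refine Subtype.ext (funext fun w' => Units.ext ?_)
  rw [coe_evalPlace_finPart_tensorEmb, hw]
  simp only [OneMemClass.coe_one, Pi.one_apply, Units.val_one, Matrix.one_kronecker_one, Matrix.reindex_apply,
    Matrix.submatrix_one_equiv]

/-- entries of `reindex ε (A ⊗ₖ 1)` lie in a subring containing the entries of `A`. [folklore] -/
theorem reindex_kronecker_one_apply_mem {R : Type} [CommRing R] {m k p : ℕ} (ε : Fin m × Fin k ≃ Fin p) (𝒪 : Subring R)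
    (A : Matrix (Fin m) (Fin m) R) (hA : ∀ i j, A i j ∈ 𝒪) (I J : Fin p) :
    Matrix.reindex ε ε (A ⊗ₖ (1 : Matrix (Fin k) (Fin k) R)) I J ∈ 𝒪 := by
  rw [Matrix.reindex_apply, Matrix.submatrix_apply, Matrix.kroneckerMap_apply, Matrix.one_apply]
  split_ifs
  · rw [mul_one]; exact hA _ _
  · rw [mul_zero]; exact 𝒪.zero_mem

/-- **`h_w ∈ U(𝔻)(𝒪_w) ⇒ (h ⊗ 1)_w ∈ U(𝔻 ⊗ V′)(𝒪_w)`** (entries of `A ⊗ₖ 1` and of `A⁻¹ ⊗ₖ 1` are integral when those of `A`, `A⁻¹` are).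
[cite: PlatonovRapinchuk1994, §5.1] -/
theorem evalPlace_finPart_tensorEmb_mem_localInt (w : HeightOneSpectrum (𝓞 (Fp L))) (h : HA L e dV hdV dW hdW)
    (hw : UnitaryGroup.evalPlace (Fp L) L (IsCMField.complexConj L) (n + n) (hermD L e dV hdV dW hdW) w
      (UnitaryGroup.finPart (Fp L) L (IsCMField.complexConj L) (n + n) (hermD L e dV hdV dW hdW) h) ∈
        UnitaryGroup.localInt L (IsCMField.complexConj L) (n + n) (hermD L e dV hdV dW hdW) w) :
    UnitaryGroup.evalPlace (Fp L) L (IsCMField.complexConj L) (n' + n') (hermD L e' dV hdV (tensorFrame L dW eW dV') (tensorFrame_real L dW hdW eW dV' hdV')) w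
      (UnitaryGroup.finPart (Fp L) L (IsCMField.complexConj L) (n' + n') (hermD L e' dV hdV (tensorFrame L dW eW dV') (tensorFrame_real L dW hdW eW dV' hdV'))
        (tensorEmb L e dV hdV dW hdW eW e' dV' hdV' h)) ∈
      UnitaryGroup.localInt L (IsCMField.complexConj L) (n' + n') (hermD L e' dV hdV (tensorFrame L dW eW dV') (tensorFrame_real L dW hdW eW dV' hdV')) w := by
  rw [UnitaryGroup.mem_localInt_iff] at hw ⊢
  intro w'
  obtain ⟨hA, hAi⟩ := (mem_glInt_iff _).1 (hw w')
  refine (mem_glInt_iff _).2 ⟨fun I J => ?_, fun I J => ?_⟩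
  · rw [coe_evalPlace_finPart_tensorEmb]
    exact reindex_kronecker_one_apply_mem _ _ _ hA I J
  · -- the inverse: `(reindex (A ⊗ 1))⁻¹ = reindex (A⁻¹ ⊗ 1)` (Mathlib `inv_reindex`, `inv_kronecker`)
    rw [Matrix.coe_units_inv, coe_evalPlace_finPart_tensorEmb, Matrix.inv_reindex, Matrix.inv_kronecker, inv_one]
    have hAi' : ∀ i j, (((UnitaryGroup.evalPlace (Fp L) L (IsCMField.complexConj L) (n + n) (hermD L e dV hdV dW hdW) w
        (UnitaryGroup.finPart (Fp L) L (IsCMField.complexConj L) (n + n) (hermD L e dV hdV dW hdW) h) :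
        UnitaryGroup.localPi L (IsCMField.complexConj L) (n + n) (hermD L e dV hdV dW hdW) w) : UnitaryGroup.LocalGLPi L (n + n) w) w' :
          Matrix (Fin (n + n)) (Fin (n + n)) (w'.1.adicCompletion L))⁻¹ i j ∈
        (ValuativeRel.valuation (w'.1.adicCompletion L)).integer := by
      intro i j
      rw [← Matrix.coe_units_inv]
      exact hAi i j
    exact reindex_kronecker_one_apply_mem _ _ _ hAi' I J

/-! ## §3 The tensor embedding carries `U(𝔻)(𝒪_v)` into `U(𝔻 ⊗ V′)(𝒪_v)` -/

/-- **T2-a — `tensorEmb (ι_v u) = ι_v u′` with `u′ ∈ U(𝔻 ⊗ V′)(𝒪_v)` for `u ∈ U(𝔻)(𝒪_v)`** (`ι_v` = ★ `UnitaryGroup.inclPlaceAdelic`): the embedding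
`h ↦ h ⊗ 1` maps the place-`v` copy of the good maximal compact of `H` into that of the big group (§2 + §0).
[cite: Kudla1994, §2 (doubled space, Siegel parabolic)] [cite: PlatonovRapinchuk1994, §5.1] [cite: BorelJacquet1979, §4.1] -/
theorem exists_mem_localInt_tensorEmb_inclPlaceAdelic (v : HeightOneSpectrum (𝓞 (Fp L)))
    (u : UnitaryGroup.localPi L (IsCMField.complexConj L) (n + n) (hermD L e dV hdV dW hdW) v)
    (hu : u ∈ UnitaryGroup.localInt L (IsCMField.complexConj L) (n + n) (hermD L e dV hdV dW hdW) v) :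
    ∃ u' : UnitaryGroup.localPi L (IsCMField.complexConj L) (n' + n') (hermD L e' dV hdV (tensorFrame L dW eW dV') (tensorFrame_real L dW hdW eW dV' hdV')) v,
      u' ∈ UnitaryGroup.localInt L (IsCMField.complexConj L) (n' + n') (hermD L e' dV hdV (tensorFrame L dW eW dV') (tensorFrame_real L dW hdW eW dV' hdV')) v ∧
      tensorEmb L e dV hdV dW hdW eW e' dV' hdV'
          (UnitaryGroup.inclPlaceAdelic (Fp L) L (IsCMField.complexConj L) (n + n) (hermD L e dV hdV dW hdW) v u) =
        UnitaryGroup.inclPlaceAdelic (Fp L) L (IsCMField.complexConj L) (n' + n')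
          (hermD L e' dV hdV (tensorFrame L dW eW dV') (tensorFrame_real L dW hdW eW dV' hdV')) v u' := by
  refine ⟨_, evalPlace_finPart_tensorEmb_mem_localInt L e dV hdV dW hdW eW e' dV' hdV' v _ ?_,
    eq_inclPlaceAdelic_of_archPart_eq_one (Fp L) L (IsCMField.complexConj L) (n' + n') _ v _ ?_ ?_⟩
  · rw [UnitaryGroup.evalPlace_finPart_inclPlaceAdelic]
    exact hu
  · exact archPart_tensorEmb_eq_one L e dV hdV dW hdW eW e' dV' hdV' _ (UnitaryGroup.archPart_inclPlaceAdelic _ _ _ _ _ v u)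
  · intro w hw
    refine evalPlace_finPart_tensorEmb_eq_one L e dV hdV dW hdW eW e' dV' hdV' w _ ?_
    rw [UnitaryGroup.finPart_inclPlaceAdelic, UnitaryGroup.evalPlace_inclPlace_of_ne _ _ _ _ _ hw]

end Summit.HodgeConjecture.HodgeConjecture.Cruxes.HLiu418.K2LiuTensorEmbPlaceComponents

end
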